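import Mathlib.Algebra.Module.ZLattice.Basic
import Mathlib.MeasureTheory.Measure.Haar.InnerProductSpace
import Mathlib.MeasureTheory.Group.FundamentalDomain
import Mathlib.MeasureTheory.Group.Integral
import Mathlib.Analysis.Complex.Isometry
import Mathlib.Analysis.SpecialFunctions.Complex.Circle
import Mathlib.MeasureTheory.Measure.Lebesgue.Complex
import Mathlib.LinearAlgebra.Complex.FiniteDimensional
import HarnessLib

/-!
# Sector sums over cosets of a plane lattice: `Σ_{z ∈ β + c(ℤ+ℤτ), ‖z‖ ≤ R} (z/‖z‖)^m = O(m R^{3/2})`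

Topic `NumberTheory/LFunctions`; namespace `Literature.NumberTheory.LFunctions.PlaneLattice`.
Definitions with bodies (`sectorWeight`, `cosetPt`, `latticeBasis`, `latPt`, `cell`, `discWeight`)
and theorems; no named fact (D-0026). Filed in support of the named fact
`murty_petersson_newform_lower_bound` (the `j = 0` CM family: partial sums of the Grössencharacter
`𝔞 ↦ χ(𝔞)(α/|α|)^m` of `ℚ(√−3)` over a congruence class `α ≡ β (mod 𝔣)` are sums of exactly this
shape with `c = e(𝔣)`, `τ = e(ζ₃)`), and it is the classical input of Hecke's proof that Hecke
`L`-functions with Grössencharacters of non-zero frequency are ENTIRE (the continuous sum vanishes).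

**Main theorem** `norm_sum_sectorWeight_le`: for `Im τ > 0`, `‖c‖ ≥ 1`, `m ≥ 1`, `R ≥ 0`, any `β`
and any finite index set `T ⊇ {p : ‖z_p‖ ≤ R + ‖c‖ + ‖cτ‖}`, `z_p = β + c(p₁ + p₂τ)`:

`‖Σ_{p ∈ T, ‖z_p‖ ≤ R} (z_p/‖z_p‖)^m‖ ≤ 16 (4κ/Im τ + 1)(4κ + 1) · m · (R + 1)(√R + 1)`, `κ = 1 + ‖τ‖`,

UNIFORM in `c` and `β` (this uniformity in the modulus is what gives polynomial dependence on the
conductor downstream). Proof (Hecke; Lang, *Algebraic Number Theory* XV / VI §3 in the language of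
homogeneously expanding domains — here a self-contained cell comparison):
* `integral_discWeight_eq_zero` — `∫_{‖x‖ ≤ R} (x/‖x‖)^m dx = 0` (rotation by `e^{iπ/m}` is a
  measure-preserving linear isometry of `ℂ` — `LinearIsometryEquiv.measurePreserving` — and multiplies
  the weight by `−1`);
* `sum_setIntegral_cell_eq_zero` — the translates `latPt p + F` of the fundamental cell
  `F = ZSpan.fundamentalDomain (c, cτ)` by `p ∈ T` are disjoint (`disjoint_cells`) and cover the
  support (`sub_latPt_floor_mem_cell`), so `Σ_p ∫_F h(z_p + y) dy = ∫ h = 0`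
  (`integral_biUnion_finset`, translation invariance);
* `norm_sum_discWeight_le` — hence `‖Σ_p h(z_p)‖ ≤ Σ_p sup_{y ∈ F} ‖h(z_p) − h(z_p + y)‖`
  (`0 < vol F < ∞`: `ZSpan.measure_fundamentalDomain_ne_zero`, `fundamentalDomain_isBounded`);
* `norm_discWeight_sub_le` + `norm_sectorWeight_sub_le` — the variation is `0` outside `R + d`,
  `≤ 2md/‖z_p‖` for `2d ≤ ‖z_p‖ ≤ R − d` (Lipschitz bound `‖u^m − v^m‖ ≤ m‖u − v‖`,
  `‖z/‖z‖ − z'/‖z'‖‖ ≤ 2‖z − z'‖/‖z‖`), `≤ 2` otherwise (`d = ‖c‖ + ‖cτ‖ = diam F`);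
* ELEMENTARY COUNTS uniform in `β`: `card_filter_norm_le` (disc: `(2r/(‖c‖Im τ)+1)(2r/‖c‖+1)`,
  the `τ`-coordinate pins `p₂`, then `p₁`), `card_filter_annulus_le` (annulus `R₁ < ‖z‖ ≤ R₂`:
  `(2R₂/(‖c‖Im τ)+1)·2(√(R₂²−R₁²)/‖c‖+1)`, two intervals per line since `√A − √B ≤ √(A−B)`),
  `card_int_mem_Icc_le`;
* `sum_shells_le` (shells `kd ≤ ‖z‖ < (k+1)d`, `O(m (R/d)^{3/2})`), `card_boundary_le`, assembly.

## References

* E. Hecke, *Eine neue Art von Zetafunktionen und ihre Beziehungen zur Verteilung der Primzahlen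
  II*, Math. Z. 6 (1920), 11–51, §§5–7 (Grössencharacters, entire continuation for non-trivial
  frequency). [cite: HeckeMathZ1920, §6]
* S. Lang, *Algebraic Number Theory*, 2nd ed., GTM 110 (1994), Ch. VI §3 Thm. 3 and Ch. XV
  (number of lattice points in homogeneously expanding domains; Hecke L-series). [folklore]
* H. Iwaniec, E. Kowalski, *Analytic Number Theory* (2004), §3.8 (Hecke characters and their
  L-functions). [cite: IwaniecKowalski2004, §3.8]

## Mathlib search

`ZSpan.fundamentalDomain`, `ZSpan.mem_fundamentalDomain`, `ZSpan.fundamentalDomain_measurableSet`,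
`ZSpan.fundamentalDomain_isBounded`, `ZSpan.measure_fundamentalDomain_ne_zero`,
`basisOfLinearIndependentOfCardEqFinrank`, `LinearIndependent.pair_iff`, `Complex.finrank_real_complex`,
`rotation`, `Circle.exp`, `LinearIsometryEquiv.measurePreserving`, `MeasurePreserving.integral_comp`,
`integral_add_left_eq_self`, `integral_biUnion_finset`,
`setIntegral_eq_integral_of_forall_compl_eq_zero`, `norm_setIntegral_le_of_norm_le_const`,
`IntegrableOn.of_bound`, `Finset.card_eq_sum_card_fiberwise`, `Finset.sum_fiberwise_of_maps_to`.
Tree: the Gaussian files `GaussianLatticePieces`/`GaussianLinePhase` treat `ℤ[i]` only and by a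
different (Vinogradov) method; `lean search 'sectorWeight|cosetPt|fundamentalDomain.*sum'`: no
prior general plane-lattice coset estimate.
-/

noncomputable section

open Complex MeasureTheory Set Filter Finset Module
open scoped Real

namespace Literature.NumberTheory.LFunctions.PlaneLattice

/-! ### The sector weight `(z/‖z‖)^m` and its Lipschitz bound -/

/-- The sector weight `w_m(z) = (z/‖z‖)^m` (`0` at `z = 0` for `m ≥ 1`). [folklore] -/
def sectorWeight (m : ℕ) (z : ℂ) : ℂ := (z / (‖z‖ : ℂ)) ^ m

/-- `‖w_m(z)‖ ≤ 1`. [folklore] -/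
theorem norm_sectorWeight_le (m : ℕ) (z : ℂ) : ‖sectorWeight m z‖ ≤ 1 := by
  unfold sectorWeight
  rw [norm_pow]
  refine pow_le_one₀ (norm_nonneg _) ?_
  by_cases hz : z = 0
  · simp [hz]
  · rw [norm_div, Complex.norm_real, Real.norm_eq_abs, abs_norm, div_self (norm_ne_zero_iff.mpr hz)]

/-- `‖u^m − v^m‖ ≤ m ‖u − v‖` for `‖u‖, ‖v‖ ≤ 1`. [folklore] -/
theorem norm_pow_sub_pow_le (m : ℕ) {u v : ℂ} (hu : ‖u‖ ≤ 1) (hv : ‖v‖ ≤ 1) :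
    ‖u ^ m - v ^ m‖ ≤ m * ‖u - v‖ := by
  induction m with
  | zero => simp
  | succ m ih =>
    have e : u ^ (m + 1) - v ^ (m + 1) = u * (u ^ m - v ^ m) + (u - v) * v ^ m := by ring
    rw [e]
    calc ‖u * (u ^ m - v ^ m) + (u - v) * v ^ m‖
        ≤ ‖u‖ * ‖u ^ m - v ^ m‖ + ‖u - v‖ * ‖v ^ m‖ := by
          refine (norm_add_le _ _).trans ?_
          rw [norm_mul, norm_mul]
      _ ≤ 1 * (m * ‖u - v‖) + ‖u - v‖ * 1 := by
          gcongr
          · rw [norm_pow]; exact pow_le_one₀ (norm_nonneg _) hv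
      _ = (m + 1 : ℕ) * ‖u - v‖ := by push_cast; ring

/-- `‖z/‖z‖ − z'/‖z'‖‖ ≤ 2‖z − z'‖/‖z‖` for `z ≠ 0`. [folklore] -/
theorem norm_unit_sub_unit_le {z z' : ℂ} (hz : z ≠ 0) :
    ‖z / (‖z‖ : ℂ) - z' / (‖z'‖ : ℂ)‖ ≤ 2 * ‖z - z'‖ / ‖z‖ := by
  have hz0 : (0 : ℝ) < ‖z‖ := norm_pos_iff.mpr hz
  by_cases hz' : z' = 0
  · subst hz'
    rw [norm_zero, Complex.ofReal_zero, div_zero, sub_zero, sub_zero, norm_div, Complex.norm_real,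
      Real.norm_eq_abs, abs_norm, div_self hz0.ne']
    rw [le_div_iff₀ hz0]
    linarith [norm_nonneg z]
  have hz0' : (0 : ℝ) < ‖z'‖ := norm_pos_iff.mpr hz'
  -- `z/‖z‖ − z'/‖z'‖ = (z − z')/‖z‖ + z'(1/‖z‖ − 1/‖z'‖)`
  have e : z / (‖z‖ : ℂ) - z' / (‖z'‖ : ℂ) =
      (z - z') / (‖z‖ : ℂ) + z' * ((‖z'‖ : ℂ) - ‖z‖) / ((‖z‖ : ℂ) * ‖z'‖) := by
    have h1 : (‖z‖ : ℂ) ≠ 0 := by exact_mod_cast hz0.ne'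
    have h2 : (‖z'‖ : ℂ) ≠ 0 := by exact_mod_cast hz0'.ne'
    field_simp
    ring
  rw [e]
  refine (norm_add_le _ _).trans ?_
  rw [norm_div, Complex.norm_real, Real.norm_eq_abs, abs_norm, norm_div, norm_mul, norm_mul,
    Complex.norm_real, Complex.norm_real, Real.norm_eq_abs, Real.norm_eq_abs, abs_norm, abs_norm,
    ← Complex.ofReal_sub, Complex.norm_real, Real.norm_eq_abs]
  have h3 : |‖z'‖ - ‖z‖| ≤ ‖z - z'‖ := by
    rw [abs_sub_comm]; exact abs_norm_sub_norm_le z z'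
  calc ‖z - z'‖ / ‖z‖ + ‖z'‖ * |‖z'‖ - ‖z‖| / (‖z‖ * ‖z'‖)
      = ‖z - z'‖ / ‖z‖ + |‖z'‖ - ‖z‖| / ‖z‖ := by field_simp
    _ ≤ ‖z - z'‖ / ‖z‖ + ‖z - z'‖ / ‖z‖ := by gcongr
    _ = 2 * ‖z - z'‖ / ‖z‖ := by ring

/-- **Lipschitz bound for the sector weight**: `‖w_m(z) − w_m(z')‖ ≤ 2m‖z − z'‖/‖z‖` (`z ≠ 0`).
[folklore] -/
theorem norm_sectorWeight_sub_le (m : ℕ) {z z' : ℂ} (hz : z ≠ 0) :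
    ‖sectorWeight m z - sectorWeight m z'‖ ≤ 2 * m * ‖z - z'‖ / ‖z‖ := by
  unfold sectorWeight
  have hu : ∀ w : ℂ, ‖w / (‖w‖ : ℂ)‖ ≤ 1 := fun w ↦ by
    by_cases hw : w = 0
    · simp [hw]
    · rw [norm_div, Complex.norm_real, Real.norm_eq_abs, abs_norm, div_self (norm_ne_zero_iff.mpr hw)]
  refine (norm_pow_sub_pow_le m (hu z) (hu z')).trans ?_
  have h := norm_unit_sub_unit_le (z' := z') hz
  calc (m : ℝ) * ‖z / (‖z‖ : ℂ) - z' / (‖z'‖ : ℂ)‖ ≤ m * (2 * ‖z - z'‖ / ‖z‖) := by gcongr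
    _ = 2 * m * ‖z - z'‖ / ‖z‖ := by ring

/-- **Rotation covariance**: `w_m(u z) = u^m w_m(z)` for `‖u‖ = 1`. [folklore] -/
theorem sectorWeight_mul (m : ℕ) {u : ℂ} (hu : ‖u‖ = 1) (z : ℂ) :
    sectorWeight m (u * z) = u ^ m * sectorWeight m z := by
  unfold sectorWeight
  rw [norm_mul, hu, one_mul, mul_div_assoc, mul_pow]

/-! ### Counting lattice points of a coset in discs and annuli (elementary box counts) -/

/-- The points of the coset `β + c(ℤ + ℤτ)`. [folklore] -/
def cosetPt (β c τ : ℂ) (p : ℤ × ℤ) : ℂ := β + c * (p.1 + p.2 * τ)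

/-- The number of integers in a real interval `[x, x + L]` is at most `L + 1`. [folklore] -/
theorem card_int_mem_Icc_le {x L : ℝ} (hL : 0 ≤ L) (s : Finset ℤ) (hs : ∀ n ∈ s, x ≤ n ∧ (n : ℝ) ≤ x + L) :
    (s.card : ℝ) ≤ L + 1 := by
  by_cases hne : s = ∅
  · simp [hne]; linarith
  obtain ⟨a, ha⟩ := Finset.nonempty_iff_ne_empty.mpr hne
  have hsub : s ⊆ Finset.Icc ⌈x⌉ ⌊x + L⌋ := by
    intro n hn
    rw [Finset.mem_Icc]
    exact ⟨Int.ceil_le.mpr (hs n hn).1, Int.le_floor.mpr (hs n hn).2⟩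
  have h1 := Finset.card_le_card hsub
  rw [Int.card_Icc] at h1
  have h2 : ((⌊x + L⌋ + 1 - ⌈x⌉).toNat : ℝ) ≤ L + 1 := by
    have hc := Int.le_ceil x
    have hf := Int.floor_le (x + L)
    rcases le_or_gt 0 (⌊x + L⌋ + 1 - ⌈x⌉) with h | h
    · have e : ((⌊x + L⌋ + 1 - ⌈x⌉).toNat : ℝ) = ((⌊x + L⌋ + 1 - ⌈x⌉ : ℤ) : ℝ) := by
        exact_mod_cast Int.toNat_of_nonneg h
      rw [e]
      push_cast
      linarith
    · rw [Int.toNat_eq_zero.mpr h.le]; push_cast; linarith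
  exact (Nat.cast_le.mpr h1).trans h2

/-- Coordinates: `cosetPt p = c (p.1 + p.2 τ + β/c)`. [folklore] -/
theorem cosetPt_eq (β c τ : ℂ) (hc : c ≠ 0) (p : ℤ × ℤ) :
    cosetPt β c τ p = c * ((p.1 : ℂ) + p.2 * τ + β / c) := by
  unfold cosetPt; field_simp; ring

/-- If `‖cosetPt p‖ ≤ r` then `|p.2 · Im τ + Im(β/c)| ≤ r/‖c‖`. [folklore] -/
theorem abs_snd_mul_im_add_le {β c τ : ℂ} (hc : c ≠ 0) {r : ℝ} {p : ℤ × ℤ}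
    (hp : ‖cosetPt β c τ p‖ ≤ r) : |(p.2 : ℝ) * τ.im + (β / c).im| ≤ r / ‖c‖ := by
  have hc0 : 0 < ‖c‖ := norm_pos_iff.mpr hc
  rw [cosetPt_eq β c τ hc, norm_mul] at hp
  have h1 : ‖((p.1 : ℂ) + p.2 * τ + β / c)‖ ≤ r / ‖c‖ := by
    rw [le_div_iff₀ hc0, mul_comm]; exact hp
  have h2 := (abs_im_le_norm _).trans h1
  simpa [Complex.add_im, Complex.mul_im] using h2

/-- If `‖cosetPt p‖ ≤ r` then `|p.1 + p.2 · Re τ + Re(β/c)| ≤ r/‖c‖`. [folklore] -/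
theorem abs_fst_add_le {β c τ : ℂ} (hc : c ≠ 0) {r : ℝ} {p : ℤ × ℤ}
    (hp : ‖cosetPt β c τ p‖ ≤ r) : |(p.1 : ℝ) + p.2 * τ.re + (β / c).re| ≤ r / ‖c‖ := by
  have hc0 : 0 < ‖c‖ := norm_pos_iff.mpr hc
  rw [cosetPt_eq β c τ hc, norm_mul] at hp
  have h1 : ‖((p.1 : ℂ) + p.2 * τ + β / c)‖ ≤ r / ‖c‖ := by
    rw [le_div_iff₀ hc0, mul_comm]; exact hp
  have h2 := (abs_re_le_norm _).trans h1
  simpa [Complex.add_re, Complex.mul_re] using h2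

/-- **Box count**: the number of coset points of norm `≤ r` in any finite set of indices is at most
`(2r/(‖c‖ Im τ) + 1)(2r/‖c‖ + 1)` (the `τ`-coordinate confines `p.2` to an interval of length
`2r/(‖c‖ Im τ)`, then `p.1` to one of length `2r/‖c‖`). [folklore] -/
theorem card_filter_norm_le (β c τ : ℂ) (hc : c ≠ 0) (hτ : 0 < τ.im) {r : ℝ} (hr : 0 ≤ r)
    (T : Finset (ℤ × ℤ)) :
    ((T.filter fun p ↦ ‖cosetPt β c τ p‖ ≤ r).card : ℝ) ≤
      (2 * r / (‖c‖ * τ.im) + 1) * (2 * r / ‖c‖ + 1) := by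
  classical
  have hc0 : 0 < ‖c‖ := norm_pos_iff.mpr hc
  set S := T.filter fun p ↦ ‖cosetPt β c τ p‖ ≤ r with hS
  -- fibre over the second coordinate
  rw [Finset.card_eq_sum_card_fiberwise (f := Prod.snd) (t := S.image Prod.snd) fun p hp ↦
    Finset.mem_image_of_mem _ hp]
  push_cast
  have hfib : ∀ b ∈ S.image Prod.snd, (((S.filter fun p ↦ p.2 = b).card : ℕ) : ℝ) ≤ 2 * r / ‖c‖ + 1 := by
    intro b _
    -- the fibre injects into the integers `a` with `|a + b Re τ + Re(β/c)| ≤ r/‖c‖`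
    have hinj : ((S.filter fun p ↦ p.2 = b).card : ℝ) = (((S.filter fun p ↦ p.2 = b).image Prod.fst).card : ℝ) := by
      rw [Finset.card_image_of_injOn]
      intro p hp q hq h
      rw [Finset.mem_coe, Finset.mem_filter] at hp hq
      exact Prod.ext h (hp.2.trans hq.2.symm)
    rw [hinj]
    refine card_int_mem_Icc_le (x := -(b * τ.re + (β / c).re) - r / ‖c‖) (L := 2 * r / ‖c‖)
      (by positivity) _ fun a ha ↦ ?_
    rw [Finset.mem_image] at ha
    obtain ⟨p, hp, rfl⟩ := ha
    rw [Finset.mem_filter] at hp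
    obtain ⟨hpS, hpb⟩ := hp
    rw [hS, Finset.mem_filter] at hpS
    have h := abs_fst_add_le (β := β) (τ := τ) hc hpS.2
    rw [hpb] at h
    rw [abs_le] at h
    have e2 : 2 * r / ‖c‖ = 2 * (r / ‖c‖) := by ring
    constructor <;> linarith [h.1, h.2]
  calc (∑ b ∈ S.image Prod.snd, ((S.filter fun p ↦ p.2 = b).card : ℝ))
      ≤ ∑ b ∈ S.image Prod.snd, (2 * r / ‖c‖ + 1) := Finset.sum_le_sum hfib
    _ = ((S.image Prod.snd).card : ℝ) * (2 * r / ‖c‖ + 1) := by rw [Finset.sum_const, nsmul_eq_mul]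
    _ ≤ (2 * r / (‖c‖ * τ.im) + 1) * (2 * r / ‖c‖ + 1) := by
      gcongr
      refine card_int_mem_Icc_le (x := (-(β / c).im - r / ‖c‖) / τ.im) (L := 2 * r / (‖c‖ * τ.im))
        (by positivity) _ fun b hb ↦ ?_
      rw [Finset.mem_image] at hb
      obtain ⟨p, hp, rfl⟩ := hb
      rw [hS, Finset.mem_filter] at hp
      have h := abs_snd_mul_im_add_le (β := β) (τ := τ) hc hp.2
      rw [abs_le] at h
      constructor
      · rw [div_le_iff₀ hτ]; linarith [h.1]
      · rw [show (-(β / c).im - r / ‖c‖) / τ.im + 2 * r / (‖c‖ * τ.im) =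
            (-(β / c).im + r / ‖c‖) / τ.im by field_simp; ring, le_div_iff₀ hτ]
        linarith [h.2]

/-- `√(p + q) ≤ √p + √q`. [folklore] -/
theorem sqrt_add_le' {p q : ℝ} (hp : 0 ≤ p) (hq : 0 ≤ q) : Real.sqrt (p + q) ≤ Real.sqrt p + Real.sqrt q := by
  rw [Real.sqrt_le_left (by positivity)]
  nlinarith [Real.sq_sqrt hp, Real.sq_sqrt hq, Real.sqrt_nonneg p, Real.sqrt_nonneg q]

/-- The real points `t ≥ 0` with `R₁² < t² + h² ≤ R₂²`... more precisely: if `0 ≤ t`, `B < t²` and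
`t² ≤ A` with `A − max B 0 ≤ L²`, then `√(max B 0) ≤ t ≤ √(max B 0) + L`. [folklore] -/
theorem mem_Icc_of_sq_bounds {t A B L : ℝ} (ht : 0 ≤ t) (hL : 0 ≤ L) (hB : B < t ^ 2) (hA : t ^ 2 ≤ A)
    (hAB : A - max B 0 ≤ L ^ 2) :
    Real.sqrt (max B 0) ≤ t ∧ t ≤ Real.sqrt (max B 0) + L := by
  constructor
  · rw [Real.sqrt_le_left ht]
    exact max_le hB.le (sq_nonneg t)
  · have h1 : t ≤ Real.sqrt A := Real.le_sqrt_of_sq_le hA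
    have hm : 0 ≤ max B 0 := le_max_right _ _
    have h2 : A ≤ max B 0 + L ^ 2 := by linarith
    have h3 : Real.sqrt A ≤ Real.sqrt (max B 0) + Real.sqrt (L ^ 2) :=
      (Real.sqrt_le_sqrt h2).trans (sqrt_add_le' hm (sq_nonneg L))
    rw [Real.sqrt_sq hL] at h3
    exact h1.trans h3

/-- **Annulus count**: the number of coset points with `R₁ < ‖z‖ ≤ R₂` in any finite index set is
at most `(2R₂/(‖c‖ Im τ) + 1) · 2(√(R₂² − R₁²)/‖c‖ + 1)`: on each line `p.2 = b` the admissible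
`p.1` lie in two intervals of length `√(R₂² − R₁²)/‖c‖` (`√A − √B ≤ √(A − B)`). [folklore] -/
theorem card_filter_annulus_le (β c τ : ℂ) (hc : c ≠ 0) (hτ : 0 < τ.im) {R₁ R₂ : ℝ} (h1 : 0 ≤ R₁)
    (h12 : R₁ ≤ R₂) (T : Finset (ℤ × ℤ)) :
    ((T.filter fun p ↦ R₁ < ‖cosetPt β c τ p‖ ∧ ‖cosetPt β c τ p‖ ≤ R₂).card : ℝ) ≤
      (2 * R₂ / (‖c‖ * τ.im) + 1) * (2 * (Real.sqrt (R₂ ^ 2 - R₁ ^ 2) / ‖c‖ + 1)) := by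
  classical
  have hc0 : 0 < ‖c‖ := norm_pos_iff.mpr hc
  have hR₂ : 0 ≤ R₂ := h1.trans h12
  set L := Real.sqrt (R₂ ^ 2 - R₁ ^ 2) / ‖c‖ with hLdef
  have hL : 0 ≤ L := by positivity
  set S := T.filter fun p ↦ R₁ < ‖cosetPt β c τ p‖ ∧ ‖cosetPt β c τ p‖ ≤ R₂ with hS
  rw [Finset.card_eq_sum_card_fiberwise (f := Prod.snd) (t := S.image Prod.snd) fun p hp ↦
    Finset.mem_image_of_mem _ hp]
  push_cast
  -- each fibre has at most `2(L + 1)` points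
  have hfib : ∀ b ∈ S.image Prod.snd, (((S.filter fun p ↦ p.2 = b).card : ℕ) : ℝ) ≤ 2 * (L + 1) := by
    intro b _
    set w : ℂ := (b : ℂ) * τ + β / c with hw
    -- points of the fibre: `a` with `R₁ < ‖c‖ ‖a + w‖ ≤ R₂`
    have hpt : ∀ p ∈ S.filter (fun p ↦ p.2 = b),
        -(w.im) ^ 2 + R₁ ^ 2 / ‖c‖ ^ 2 < ((p.1 : ℝ) + w.re) ^ 2 ∧
          ((p.1 : ℝ) + w.re) ^ 2 ≤ R₂ ^ 2 / ‖c‖ ^ 2 - (w.im) ^ 2 := by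
      intro p hp
      rw [Finset.mem_filter, hS, Finset.mem_filter] at hp
      obtain ⟨⟨-, hlo, hhi⟩, hpb⟩ := hp
      have hz : cosetPt β c τ p = c * ((p.1 : ℂ) + w) := by
        rw [cosetPt_eq β c τ hc, hw, ← hpb]; ring
      have hxy : (p.1 : ℂ) + w = ⟨(p.1 : ℝ) + w.re, w.im⟩ := by
        apply Complex.ext <;> simp
      have hn : ‖cosetPt β c τ p‖ ^ 2 = ‖c‖ ^ 2 * (((p.1 : ℝ) + w.re) ^ 2 + w.im ^ 2) := by
        rw [hz, norm_mul, mul_pow, hxy]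
        have e : ‖(⟨(p.1 : ℝ) + w.re, w.im⟩ : ℂ)‖ ^ 2 = ((p.1 : ℝ) + w.re) ^ 2 + w.im ^ 2 := by
          rw [Complex.sq_norm, Complex.normSq_mk]; ring
        rw [e]
      have hc2 : 0 < ‖c‖ ^ 2 := by positivity
      constructor
      · have h' : R₁ ^ 2 < ‖cosetPt β c τ p‖ ^ 2 := pow_lt_pow_left₀ hlo h1 two_ne_zero
        rw [hn] at h'
        have h'' : R₁ ^ 2 / ‖c‖ ^ 2 < ((p.1 : ℝ) + w.re) ^ 2 + w.im ^ 2 := by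
          rw [div_lt_iff₀ hc2]; linarith [h']
        linarith
      · have h' : ‖cosetPt β c τ p‖ ^ 2 ≤ R₂ ^ 2 := pow_le_pow_left₀ (norm_nonneg _) hhi 2
        rw [hn] at h'
        have h'' : ((p.1 : ℝ) + w.re) ^ 2 + w.im ^ 2 ≤ R₂ ^ 2 / ‖c‖ ^ 2 := by
          rw [le_div_iff₀ hc2]; linarith [h']
        linarith
    set B : ℝ := -(w.im) ^ 2 + R₁ ^ 2 / ‖c‖ ^ 2 with hB
    set A : ℝ := R₂ ^ 2 / ‖c‖ ^ 2 - (w.im) ^ 2 with hA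
    have hAB : A - max B 0 ≤ L ^ 2 := by
      rw [hLdef, div_pow, Real.sq_sqrt (by nlinarith)]
      rcases le_total B 0 with hB0 | hB0
      · rw [max_eq_right hB0]
        have : R₁ ^ 2 / ‖c‖ ^ 2 ≤ (w.im) ^ 2 := by linarith
        rw [sub_div]
        linarith
      · rw [max_eq_left hB0, sub_div]
        linarith
    set x₀ := Real.sqrt (max B 0) with hx₀
    -- split by the sign of `a + Re w`
    have hsplit := Finset.card_filter_add_card_filter_not (s := S.filter fun p ↦ p.2 = b)
      (fun p ↦ 0 ≤ (p.1 : ℝ) + w.re)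
    have hpos : (((S.filter fun p ↦ p.2 = b).filter fun p ↦ 0 ≤ (p.1 : ℝ) + w.re).card : ℝ) ≤ L + 1 := by
      have hinj : (((S.filter fun p ↦ p.2 = b).filter fun p ↦ 0 ≤ (p.1 : ℝ) + w.re).card : ℝ) =
          ((((S.filter fun p ↦ p.2 = b).filter fun p ↦ 0 ≤ (p.1 : ℝ) + w.re).image Prod.fst).card : ℝ) := by
        rw [Finset.card_image_of_injOn]
        intro p hp q hq h
        simp only [Finset.coe_filter, Set.mem_setOf_eq, Finset.mem_filter] at hp hq
        exact Prod.ext h (hp.1.2.trans hq.1.2.symm)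
      rw [hinj]
      refine card_int_mem_Icc_le (x := x₀ - w.re) (L := L) hL _ fun a ha ↦ ?_
      rw [Finset.mem_image] at ha
      obtain ⟨p, hp, rfl⟩ := ha
      rw [Finset.mem_filter] at hp
      obtain ⟨hpS, hsign⟩ := hp
      obtain ⟨hlo, hhi⟩ := hpt p hpS
      obtain ⟨h1', h2'⟩ := mem_Icc_of_sq_bounds hsign hL hlo hhi hAB
      constructor <;> linarith
    have hneg : (((S.filter fun p ↦ p.2 = b).filter fun p ↦ ¬ 0 ≤ (p.1 : ℝ) + w.re).card : ℝ) ≤ L + 1 := by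
      have hinj : (((S.filter fun p ↦ p.2 = b).filter fun p ↦ ¬ 0 ≤ (p.1 : ℝ) + w.re).card : ℝ) =
          ((((S.filter fun p ↦ p.2 = b).filter fun p ↦ ¬ 0 ≤ (p.1 : ℝ) + w.re).image Prod.fst).card : ℝ) := by
        rw [Finset.card_image_of_injOn]
        intro p hp q hq h
        simp only [Finset.coe_filter, Set.mem_setOf_eq, Finset.mem_filter] at hp hq
        exact Prod.ext h (hp.1.2.trans hq.1.2.symm)
      rw [hinj]
      refine card_int_mem_Icc_le (x := -x₀ - L - w.re) (L := L) hL _ fun a ha ↦ ?_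
      rw [Finset.mem_image] at ha
      obtain ⟨p, hp, rfl⟩ := ha
      rw [Finset.mem_filter] at hp
      obtain ⟨hpS, hsign⟩ := hp
      obtain ⟨hlo, hhi⟩ := hpt p hpS
      have hsign' : 0 ≤ -((p.1 : ℝ) + w.re) := by linarith [not_le.mp hsign]
      obtain ⟨h1', h2'⟩ := mem_Icc_of_sq_bounds (t := -((p.1 : ℝ) + w.re)) hsign' hL
        (by rw [neg_sq]; exact hlo) (by rw [neg_sq]; exact hhi) hAB
      constructor <;> linarith
    have e := congrArg (fun n : ℕ ↦ (n : ℝ)) hsplit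
    push_cast at e
    linarith
  calc (∑ b ∈ S.image Prod.snd, ((S.filter fun p ↦ p.2 = b).card : ℝ))
      ≤ ∑ b ∈ S.image Prod.snd, 2 * (L + 1) := Finset.sum_le_sum hfib
    _ = ((S.image Prod.snd).card : ℝ) * (2 * (L + 1)) := by rw [Finset.sum_const, nsmul_eq_mul]
    _ ≤ (2 * R₂ / (‖c‖ * τ.im) + 1) * (2 * (L + 1)) := by
      gcongr
      refine card_int_mem_Icc_le (x := (-(β / c).im - R₂ / ‖c‖) / τ.im) (L := 2 * R₂ / (‖c‖ * τ.im))
        (by positivity) _ fun b hb ↦ ?_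
      rw [Finset.mem_image] at hb
      obtain ⟨p, hp, rfl⟩ := hb
      rw [hS, Finset.mem_filter] at hp
      have h := abs_snd_mul_im_add_le (β := β) (τ := τ) hc hp.2.2
      rw [abs_le] at h
      constructor
      · rw [div_le_iff₀ hτ]; linarith [h.1]
      · rw [show (-(β / c).im - R₂ / ‖c‖) / τ.im + 2 * R₂ / (‖c‖ * τ.im) =
            (-(β / c).im + R₂ / ‖c‖) / τ.im by field_simp; ring, le_div_iff₀ hτ]
        linarith [h.2]

/-! ### The lattice `c(ℤ + ℤτ)` as a `ℤ`-span of a real basis of `ℂ`, and its fundamental cell -/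

section Cell

variable {c τ : ℂ} (hc : c ≠ 0) (hτ : 0 < τ.im)

include hc hτ in
/-- `c` and `cτ` are `ℝ`-linearly independent. [folklore] -/
theorem linearIndependent_pair : LinearIndependent ℝ ![c, c * τ] := by
  rw [LinearIndependent.pair_iff]
  intro s t h
  have h' : c * ((s : ℂ) + t * τ) = 0 := by
    simp only [Complex.real_smul] at h
    linear_combination h
  have h'' : (s : ℂ) + t * τ = 0 := (mul_eq_zero.mp h').resolve_left hc
  have him := congrArg Complex.im h''
  have hre := congrArg Complex.re h''
  simp only [Complex.add_im, Complex.ofReal_im, Complex.mul_im, Complex.ofReal_re, zero_add,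
    zero_mul, add_zero, Complex.zero_im, mul_eq_zero, Complex.add_re, Complex.mul_re,
    Complex.zero_re, sub_zero] at him hre
  have ht : t = 0 := him.resolve_right hτ.ne'
  rw [ht, zero_mul, add_zero] at hre
  exact ⟨hre, ht⟩

/-- The real basis `(c, cτ)` of `ℂ`. [folklore] -/
def latticeBasis : Basis (Fin 2) ℝ ℂ :=
  basisOfLinearIndependentOfCardEqFinrank (linearIndependent_pair hc hτ)
    (by simp [Complex.finrank_real_complex])

/-- `b₀ = c`. [folklore] -/
theorem latticeBasis_apply_zero : latticeBasis hc hτ 0 = c := by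
  simp [latticeBasis]

/-- `b₁ = cτ`. [folklore] -/
theorem latticeBasis_apply_one : latticeBasis hc hτ 1 = c * τ := by
  simp [latticeBasis]

/-- The lattice point `c(a + bτ) = a • b₀ + b • b₁`. [folklore] -/
def latPt (c τ : ℂ) (p : ℤ × ℤ) : ℂ := c * ((p.1 : ℂ) + p.2 * τ)

omit hc hτ in
/-- `cosetPt = β + latPt`. [folklore] -/
theorem cosetPt_eq_add_latPt (β c τ : ℂ) (p : ℤ × ℤ) : cosetPt β c τ p = β + latPt c τ p := rfl

/-- The coordinates of `x + latPt p` are those of `x` shifted by `p`. [folklore] -/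
theorem repr_add_latPt (x : ℂ) (p : ℤ × ℤ) (i : Fin 2) :
    (latticeBasis hc hτ).repr (x + latPt c τ p) i =
      (latticeBasis hc hτ).repr x i + (![(p.1 : ℝ), (p.2 : ℝ)] i) := by
  have e : latPt c τ p = (p.1 : ℝ) • latticeBasis hc hτ 0 + (p.2 : ℝ) • latticeBasis hc hτ 1 := by
    rw [latticeBasis_apply_zero, latticeBasis_apply_one, latPt]
    simp only [Complex.real_smul]
    push_cast
    ring
  rw [e, map_add, map_add, map_smul, map_smul, (latticeBasis hc hτ).repr_self,
    (latticeBasis hc hτ).repr_self]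
  fin_cases i <;> simp

/-- The fundamental cell `F = {s c + t cτ : s, t ∈ [0,1)}`. [folklore] -/
abbrev cell : Set ℂ := ZSpan.fundamentalDomain (latticeBasis hc hτ)

/-- Points of the cell have norm at most `d = ‖c‖ + ‖cτ‖`. [folklore] -/
theorem norm_le_of_mem_cell {y : ℂ} (hy : y ∈ cell hc hτ) : ‖y‖ ≤ ‖c‖ + ‖c * τ‖ := by
  have hrep := (latticeBasis hc hτ).sum_repr y
  rw [ZSpan.mem_fundamentalDomain] at hy
  rw [← hrep, Fin.sum_univ_two, latticeBasis_apply_zero, latticeBasis_apply_one]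
  have h0 := hy 0
  have h1 := hy 1
  rw [Set.mem_Ico] at h0 h1
  refine (norm_add_le _ _).trans (add_le_add ?_ ?_)
  · rw [norm_smul, Real.norm_eq_abs, abs_of_nonneg h0.1]
    exact mul_le_of_le_one_left (norm_nonneg _) h0.2.le
  · rw [norm_smul, Real.norm_eq_abs, abs_of_nonneg h1.1]
    exact mul_le_of_le_one_left (norm_nonneg _) h1.2.le

/-- Membership in a translated cell in coordinates. [folklore] -/
theorem sub_latPt_mem_cell_iff (x : ℂ) (p : ℤ × ℤ) :
    x - latPt c τ p ∈ cell hc hτ ↔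
      ∀ i : Fin 2, (latticeBasis hc hτ).repr x i - (![(p.1 : ℝ), (p.2 : ℝ)] i) ∈ Set.Ico (0 : ℝ) 1 := by
  rw [ZSpan.mem_fundamentalDomain]
  have h := repr_add_latPt hc hτ x (-p.1, -p.2)
  have e : x - latPt c τ p = x + latPt c τ (-p.1, -p.2) := by
    simp only [latPt]; push_cast; ring
  simp_rw [e]
  constructor <;> intro H i <;> have Hi := H i
  · rw [h] at Hi
    fin_cases i <;> simp at Hi ⊢ <;> constructor <;> linarith [Hi.1, Hi.2]
  · rw [h]
    fin_cases i <;> simp at Hi ⊢ <;> constructor <;> linarith [Hi.1, Hi.2]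

/-- **Distinct translates of the cell are disjoint.** [folklore] -/
theorem disjoint_cells {p q : ℤ × ℤ} (hpq : p ≠ q) :
    Disjoint ((fun x ↦ x - latPt c τ p) ⁻¹' cell hc hτ) ((fun x ↦ x - latPt c τ q) ⁻¹' cell hc hτ) := by
  rw [Set.disjoint_left]
  intro x hp hq
  rw [Set.mem_preimage, sub_latPt_mem_cell_iff] at hp hq
  apply hpq
  have key : ∀ i : Fin 2, (![(p.1 : ℝ), (p.2 : ℝ)] i) = (![(q.1 : ℝ), (q.2 : ℝ)] i) := by
    intro i
    have h1 := hp i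
    have h2 := hq i
    rw [Set.mem_Ico] at h1 h2
    -- two integers (as reals) in a window of width `< 1` around `repr x i` coincide
    have hint : ∃ n : ℤ, (![(p.1 : ℝ), (p.2 : ℝ)] i) - (![(q.1 : ℝ), (q.2 : ℝ)] i) = n := by
      fin_cases i
      · exact ⟨p.1 - q.1, by push_cast; rfl⟩
      · exact ⟨p.2 - q.2, by push_cast; rfl⟩
    obtain ⟨n, hn⟩ := hint
    have hlt : |(n : ℝ)| < 1 := by rw [← hn, abs_lt]; constructor <;> linarith
    have hn0 : n = 0 := by
      have : |n| < 1 := by exact_mod_cast hlt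
      exact Int.abs_lt_one_iff.mp this
    rw [hn0, Int.cast_zero, sub_eq_zero] at hn
    exact hn
  have h0 := key 0
  have h1 := key 1
  simp only [Matrix.cons_val_zero, Matrix.cons_val_one, Int.cast_inj] at h0 h1
  exact Prod.ext h0 h1

/-- **Every point lies in the translate of the cell indexed by its integer coordinates.** [folklore] -/
theorem sub_latPt_floor_mem_cell (x : ℂ) :
    x - latPt c τ (⌊(latticeBasis hc hτ).repr x 0⌋, ⌊(latticeBasis hc hτ).repr x 1⌋) ∈ cell hc hτ := by
  rw [sub_latPt_mem_cell_iff]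
  intro i
  fin_cases i <;> simp [Int.fract_lt_one]

end Cell

/-! ### The disc-restricted weight, its vanishing integral, and the cell decomposition -/

section Integral

/-- The weight restricted to the disc: `h(x) = w_m(x)` if `‖x‖ ≤ R`, else `0`. [folklore] -/
def discWeight (m : ℕ) (R : ℝ) (x : ℂ) : ℂ := if ‖x‖ ≤ R then sectorWeight m x else 0

/-- `w_m` is measurable. [folklore] -/
theorem measurable_sectorWeight (m : ℕ) : Measurable (sectorWeight m) := by
  unfold sectorWeight
  exact (measurable_id.div (Complex.measurable_ofReal.comp measurable_norm)).pow_const m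

/-- `discWeight` as an indicator. [folklore] -/
theorem discWeight_eq_indicator (m : ℕ) (R : ℝ) :
    discWeight m R = (Metric.closedBall (0 : ℂ) R).indicator (sectorWeight m) := by
  funext x
  simp [discWeight, Set.indicator, Metric.mem_closedBall, dist_zero_right]

/-- `‖discWeight‖ ≤ 1`. [folklore] -/
theorem norm_discWeight_le (m : ℕ) (R : ℝ) (x : ℂ) : ‖discWeight m R x‖ ≤ 1 := by
  unfold discWeight
  split_ifs
  · exact norm_sectorWeight_le m x
  · simp

/-- `discWeight` is integrable (bounded, supported in a disc). [folklore] -/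
theorem integrable_discWeight (m : ℕ) (R : ℝ) : Integrable (discWeight m R) := by
  rw [discWeight_eq_indicator, integrable_indicator_iff measurableSet_closedBall]
  refine IntegrableOn.of_bound measure_closedBall_lt_top
    (measurable_sectorWeight m).aestronglyMeasurable.restrict 1 ?_
  exact Eventually.of_forall fun x ↦ norm_sectorWeight_le m x

/-- `discWeight (β + ·)` is integrable. [folklore] -/
theorem integrable_discWeight_add (m : ℕ) (R : ℝ) (β : ℂ) : Integrable fun y ↦ discWeight m R (β + y) :=
  Integrable.comp_add_left (integrable_discWeight m R) β

/-- **The integral of the disc-restricted weight vanishes** (`m ≥ 1`): the rotation by `e^{iπ/m}`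
preserves Lebesgue measure and multiplies the weight by `e^{iπ} = −1`. [folklore] -/
theorem integral_discWeight_eq_zero {m : ℕ} (hm : 1 ≤ m) (R : ℝ) : ∫ x, discWeight m R x = 0 := by
  set u : Circle := Circle.exp (π / m) with hu
  have hm0 : (m : ℂ) ≠ 0 := by exact_mod_cast (Nat.one_le_iff_ne_zero.mp hm)
  have hum : (u : ℂ) ^ m = -1 := by
    rw [hu, Circle.coe_exp, ← Complex.exp_nat_mul, ← Complex.exp_pi_mul_I]
    congr 1
    push_cast
    field_simp
  have hu1 : ‖(u : ℂ)‖ = 1 := Circle.norm_coe u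
  have hcov : ∀ x, discWeight m R ((u : ℂ) * x) = (u : ℂ) ^ m * discWeight m R x := by
    intro x
    simp only [discWeight, norm_mul, hu1, one_mul]
    split_ifs
    · exact sectorWeight_mul m hu1 x
    · simp
  have hrot : ∫ x, discWeight m R x = ∫ x, discWeight m R ((u : ℂ) * x) := by
    have hmp := (rotation u).measurePreserving
    have h : ∫ x, discWeight m R ((u : ℂ) * x) = ∫ y, discWeight m R y :=
      hmp.integral_comp (rotation u).toHomeomorph.measurableEmbedding (discWeight m R)
    exact h.symm
  have key : ∫ x, discWeight m R x = (u : ℂ) ^ m * ∫ x, discWeight m R x := by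
    calc ∫ x, discWeight m R x = ∫ x, discWeight m R ((u : ℂ) * x) := hrot
      _ = ∫ x, (u : ℂ) ^ m * discWeight m R x := by
          congr 1; funext x; exact hcov x
      _ = (u : ℂ) ^ m * ∫ x, discWeight m R x := integral_const_mul _ _
  rw [hum] at key
  linear_combination key / 2

variable {c τ : ℂ} (hc : c ≠ 0) (hτ : 0 < τ.im)

/-- The translated cells are measurable. [folklore] -/
theorem measurableSet_cell_preimage (p : ℤ × ℤ) :
    MeasurableSet ((fun x ↦ x - latPt c τ p) ⁻¹' cell hc hτ) :=
  (ZSpan.fundamentalDomain_measurableSet _).preimage (measurable_sub_const _)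

/-- The cell has finite measure. [folklore] -/
theorem volume_cell_lt_top : volume (cell hc hτ) < ⊤ :=
  (ZSpan.fundamentalDomain_isBounded _).measure_lt_top

/-- The cell has positive measure. [folklore] -/
theorem volume_real_cell_pos : 0 < volume.real (cell hc hτ) := by
  rw [Measure.real, ENNReal.toReal_pos_iff]
  exact ⟨pos_iff_ne_zero.mpr (ZSpan.measure_fundamentalDomain_ne_zero _), volume_cell_lt_top hc hτ⟩

/-- Integral over a translated cell = integral over the cell of the translated function. [folklore] -/
theorem setIntegral_cell_preimage (f : ℂ → ℂ) (p : ℤ × ℤ) :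
    ∫ x in (fun x ↦ x - latPt c τ p) ⁻¹' cell hc hτ, f x = ∫ y in cell hc hτ, f (latPt c τ p + y) := by
  rw [← integral_indicator (measurableSet_cell_preimage hc hτ p),
    ← integral_indicator (ZSpan.fundamentalDomain_measurableSet _),
    ← integral_add_left_eq_self _ (latPt c τ p)]
  congr 1
  funext y
  have hiff : latPt c τ p + y ∈ (fun x ↦ x - latPt c τ p) ⁻¹' cell hc hτ ↔ y ∈ cell hc hτ := by
    simp
  by_cases hy : y ∈ cell hc hτ
  · rw [Set.indicator_of_mem (hiff.mpr hy), Set.indicator_of_mem hy]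
  · rw [Set.indicator_of_notMem (mt hiff.mp hy), Set.indicator_of_notMem hy]

/-- **The cell decomposition**: if `T` contains every index `p` with `‖cosetPt p‖ ≤ R + d`
(`d = ‖c‖ + ‖cτ‖`), then `Σ_{p ∈ T} ∫_F h_β(latPt p + y) dy = ∫ h_β = 0` for
`h_β(y) = discWeight m R (β + y)`, `m ≥ 1` (the cells `latPt p + F`, `p ∈ T`, are disjoint and cover
the support of `h_β`). [folklore] -/
theorem sum_setIntegral_cell_eq_zero {m : ℕ} (hm : 1 ≤ m) (R : ℝ) (β : ℂ) (T : Finset (ℤ × ℤ))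
    (hT : ∀ p : ℤ × ℤ, ‖cosetPt β c τ p‖ ≤ R + (‖c‖ + ‖c * τ‖) → p ∈ T) :
    ∑ p ∈ T, ∫ y in cell hc hτ, discWeight m R (β + (latPt c τ p + y)) = 0 := by
  set h : ℂ → ℂ := fun y ↦ discWeight m R (β + y) with hh
  have hint : Integrable h := integrable_discWeight_add m R β
  -- the union of the cells indexed by `T`
  have hU : ∫ x in ⋃ p ∈ T, (fun x ↦ x - latPt c τ p) ⁻¹' cell hc hτ, h x = ∫ x, h x := by
    refine setIntegral_eq_integral_of_forall_compl_eq_zero fun x hx ↦ ?_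
    by_contra hne
    apply hx
    -- `h x ≠ 0` forces `‖β + x‖ ≤ R`, and `x` lies in the cell of its floor coordinates
    have hxR : ‖β + x‖ ≤ R := by
      by_contra hgt
      exact hne (by simp [hh, discWeight, hgt])
    set p₀ : ℤ × ℤ := (⌊(latticeBasis hc hτ).repr x 0⌋, ⌊(latticeBasis hc hτ).repr x 1⌋)
    have hcell := sub_latPt_floor_mem_cell hc hτ x
    have hp₀ : p₀ ∈ T := by
      refine hT p₀ ?_
      have hd := norm_le_of_mem_cell hc hτ hcell
      calc ‖cosetPt β c τ p₀‖ = ‖(β + x) - (x - latPt c τ p₀)‖ := by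
            rw [cosetPt_eq_add_latPt]; ring_nf
        _ ≤ ‖β + x‖ + ‖x - latPt c τ p₀‖ := norm_sub_le _ _
        _ ≤ R + (‖c‖ + ‖c * τ‖) := add_le_add hxR hd
    simp only [Set.mem_iUnion, Set.mem_preimage]
    exact ⟨p₀, hp₀, hcell⟩
  rw [integral_biUnion_finset T (fun p _ ↦ measurableSet_cell_preimage hc hτ p)
    (fun p _ q _ hpq ↦ disjoint_cells hc hτ hpq) (fun p _ ↦ hint.integrableOn)] at hU
  simp_rw [setIntegral_cell_preimage hc hτ h] at hU
  rw [hU, hh, integral_add_left_eq_self, integral_discWeight_eq_zero hm]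

end Integral

/-! ### The main estimate -/

section Main

variable {c τ : ℂ} (hc : c ≠ 0) (hτ : 0 < τ.im)

/-- The pointwise variation bound `V_p` on a cell: `‖h(z) − h(z + y)‖ ≤ V` for `‖y‖ ≤ d`, where
`V = 0` far outside the disc, `V = 2md/‖z‖` well inside, `V = 2` otherwise. [folklore] -/
theorem norm_discWeight_sub_le {m : ℕ} {R d : ℝ} (hd : 0 < d) {z y : ℂ} (hy : ‖y‖ ≤ d) :
    ‖discWeight m R z - discWeight m R (z + y)‖ ≤
      if R + d < ‖z‖ then 0 else if 2 * d ≤ ‖z‖ ∧ ‖z‖ + d ≤ R then 2 * m * d / ‖z‖ else 2 := by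
  split_ifs with h1 h2
  · -- both vanish
    have hz : ¬ ‖z‖ ≤ R := by linarith
    have hzy : ¬ ‖z + y‖ ≤ R := by
      intro h
      have h' : ‖z‖ ≤ ‖z + y‖ + ‖y‖ := by
        calc ‖z‖ = ‖(z + y) - y‖ := by rw [add_sub_cancel_right]
          _ ≤ ‖z + y‖ + ‖y‖ := norm_sub_le _ _
      linarith
    simp [discWeight, hz, hzy]
  · -- both inside the disc, `z ≠ 0`
    have hz : ‖z‖ ≤ R := by linarith
    have hzy : ‖z + y‖ ≤ R := (norm_add_le _ _).trans (by linarith)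
    have hz0 : z ≠ 0 := by
      intro h0; rw [h0, norm_zero] at h2; linarith
    simp only [discWeight, hz, hzy, if_true]
    calc ‖sectorWeight m z - sectorWeight m (z + y)‖ ≤ 2 * m * ‖z - (z + y)‖ / ‖z‖ :=
          norm_sectorWeight_sub_le m hz0
      _ = 2 * m * ‖y‖ / ‖z‖ := by rw [sub_add_cancel_left, norm_neg]
      _ ≤ 2 * m * d / ‖z‖ := by gcongr
  · exact (norm_sub_le _ _).trans (by linarith [norm_discWeight_le m R z, norm_discWeight_le m R (z + y)])

include hc hτ in
/-- **The sum is controlled by the total variation over the cells**: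
`‖Σ_{p ∈ T} h(z_p)‖ ≤ Σ_{p ∈ T} V_p` (multiply by `vol F`, use `Σ_p ∫_F h(z_p + y) dy = 0` and
`‖∫_F (h(z_p) − h(z_p + y)) dy‖ ≤ V_p vol F`). [folklore] -/
theorem norm_sum_discWeight_le {m : ℕ} (hm : 1 ≤ m) (R : ℝ) (β : ℂ) (T : Finset (ℤ × ℤ))
    (hT : ∀ p : ℤ × ℤ, ‖cosetPt β c τ p‖ ≤ R + (‖c‖ + ‖c * τ‖) → p ∈ T) :
    ‖∑ p ∈ T, discWeight m R (cosetPt β c τ p)‖ ≤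
      ∑ p ∈ T, (if R + (‖c‖ + ‖c * τ‖) < ‖cosetPt β c τ p‖ then (0 : ℝ) else
        if 2 * (‖c‖ + ‖c * τ‖) ≤ ‖cosetPt β c τ p‖ ∧ ‖cosetPt β c τ p‖ + (‖c‖ + ‖c * τ‖) ≤ R
        then 2 * m * (‖c‖ + ‖c * τ‖) / ‖cosetPt β c τ p‖ else 2) := by
  set d := ‖c‖ + ‖c * τ‖ with hd
  have hd0 : 0 < d := by
    have : 0 < ‖c‖ := norm_pos_iff.mpr hc
    positivity
  set v := volume.real (cell hc hτ) with hv
  have hv0 : 0 < v := volume_real_cell_pos hc hτ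
  set z := cosetPt β c τ with hz
  -- `v • S = Σ_p ∫_F (h(z p) - h(z p + y))`
  have hint : ∀ p, IntegrableOn (fun y ↦ discWeight m R (z p + y)) (cell hc hτ) := fun p ↦
    (integrable_discWeight_add m R (z p)).integrableOn
  have hconst : ∀ p, IntegrableOn (fun _ : ℂ ↦ discWeight m R (z p)) (cell hc hτ) := fun p ↦
    integrableOn_const (volume_cell_lt_top hc hτ).ne
  have hzero : ∑ p ∈ T, ∫ y in cell hc hτ, discWeight m R (z p + y) = 0 := by
    have h := sum_setIntegral_cell_eq_zero hc hτ hm R β T hT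
    simp_rw [← add_assoc] at h
    exact h
  have key : ((v : ℝ) : ℂ) * ∑ p ∈ T, discWeight m R (z p) =
      ∑ p ∈ T, ∫ y in cell hc hτ, (discWeight m R (z p) - discWeight m R (z p + y)) := by
    rw [Finset.mul_sum]
    rw [← sub_zero (∑ p ∈ T, (v : ℂ) * discWeight m R (z p)), ← hzero, ← Finset.sum_sub_distrib]
    refine Finset.sum_congr rfl fun p _ ↦ ?_
    rw [integral_sub (hconst p) (hint p), setIntegral_const, hv, Complex.real_smul]
  -- norms
  have hnorm : v * ‖∑ p ∈ T, discWeight m R (z p)‖ ≤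
      ∑ p ∈ T, (if R + d < ‖z p‖ then (0 : ℝ) else
        if 2 * d ≤ ‖z p‖ ∧ ‖z p‖ + d ≤ R then 2 * m * d / ‖z p‖ else 2) * v := by
    have h1 : v * ‖∑ p ∈ T, discWeight m R (z p)‖ = ‖((v : ℝ) : ℂ) * ∑ p ∈ T, discWeight m R (z p)‖ := by
      rw [norm_mul, Complex.norm_real, Real.norm_eq_abs, abs_of_pos hv0]
    rw [h1, key]
    refine (norm_sum_le _ _).trans (Finset.sum_le_sum fun p _ ↦ ?_)
    refine norm_setIntegral_le_of_norm_le_const (volume_cell_lt_top hc hτ) fun y hy ↦ ?_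
    exact norm_discWeight_sub_le hd0 (norm_le_of_mem_cell hc hτ hy)
  rw [← Finset.sum_mul] at hnorm
  nlinarith [hnorm, hv0, norm_nonneg (∑ p ∈ T, discWeight m R (z p))]

/-- Dominating the variation by the inner part and the boundary part. [folklore] -/
theorem variation_le {m : ℕ} {R d : ℝ} (hd : 0 < d) (ρ : ℝ) :
    (if R + d < ρ then (0 : ℝ) else if 2 * d ≤ ρ ∧ ρ + d ≤ R then 2 * m * d / ρ else 2) ≤
      (if 2 * d ≤ ρ ∧ ρ + d ≤ R then 2 * m * d / ρ else 0) +
        (if ρ ≤ R + d ∧ ¬ (2 * d ≤ ρ ∧ ρ + d ≤ R) then 2 else 0) := by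
  split_ifs <;> first | linarith | simp_all

include hc hτ in
/-- **The inner (Lipschitz) part, by dyadic-free shells**: with `k(p) = ⌊‖z_p‖/d⌋`,
`Σ_{2d ≤ ‖z_p‖ ≤ R−d} 2md/‖z_p‖ ≤ 4m (4d/(‖c‖ Im τ) + 1)(2d/‖c‖ + 1) (R/d)^{3/2}` — each shell
`k d ≤ ‖z‖ < (k+1)d` has `≤ (2(k+1)d/(‖c‖Im τ)+1)·2(2d√k/‖c‖+1)` points (annulus count) each weighing
`≤ 2m/k`. [folklore] -/
theorem sum_shells_le (β : ℂ) {m : ℕ} {R d : ℝ} (hR : 0 ≤ R) (hd : 0 < d) (T : Finset (ℤ × ℤ)) :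
    ∑ p ∈ T.filter (fun p ↦ 2 * d ≤ ‖cosetPt β c τ p‖ ∧ ‖cosetPt β c τ p‖ + d ≤ R),
        2 * m * d / ‖cosetPt β c τ p‖ ≤
      4 * m * (4 * d / (‖c‖ * τ.im) + 1) * (2 * d / ‖c‖ + 1) * ((R / d) * Real.sqrt (R / d)) := by
  classical
  have hc0 : 0 < ‖c‖ := norm_pos_iff.mpr hc
  set z := cosetPt β c τ with hz
  set A := T.filter (fun p ↦ 2 * d ≤ ‖z p‖ ∧ ‖z p‖ + d ≤ R) with hA
  set kf : ℤ × ℤ → ℕ := fun p ↦ ⌊‖z p‖ / d⌋₊ with hkf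
  set K : ℕ := ⌊R / d⌋₊ with hK
  -- basic facts on the fibre index
  have hmem : ∀ p ∈ A, (kf p : ℝ) * d ≤ ‖z p‖ ∧ ‖z p‖ < (kf p + 1) * d ∧ 2 ≤ kf p ∧ kf p ≤ K := by
    intro p hp
    rw [hA, Finset.mem_filter] at hp
    obtain ⟨-, h2d, hR⟩ := hp
    have hnn : 0 ≤ ‖z p‖ / d := by positivity
    refine ⟨?_, ?_, ?_, ?_⟩
    · have := Nat.floor_le hnn
      rw [hkf]
      rwa [le_div_iff₀ hd] at this
    · have := Nat.lt_floor_add_one (‖z p‖ / d)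
      rw [hkf]
      rwa [div_lt_iff₀ hd] at this
    · rw [hkf]
      refine Nat.le_floor ?_
      push_cast
      rwa [le_div_iff₀ hd]
    · rw [hkf, hK]
      exact Nat.floor_le_floor (by rw [div_le_div_iff_of_pos_right hd]; linarith)
  have hmaps : ∀ p ∈ A, kf p ∈ Finset.Icc 2 K := fun p hp ↦ by
    rw [Finset.mem_Icc]; exact ⟨(hmem p hp).2.2.1, (hmem p hp).2.2.2⟩
  rw [← Finset.sum_fiberwise_of_maps_to hmaps]
  -- per-fibre bound
  have hfib : ∀ k ∈ Finset.Icc 2 K,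
      ∑ p ∈ A.filter (fun p ↦ kf p = k), 2 * m * d / ‖z p‖ ≤
        4 * m * (4 * d / (‖c‖ * τ.im) + 1) * (2 * d / ‖c‖ + 1) * Real.sqrt K := by
    intro k hk
    rw [Finset.mem_Icc] at hk
    have hk1 : (1 : ℝ) ≤ k := by exact_mod_cast (by omega : 1 ≤ k)
    have hkK : (k : ℝ) ≤ K := by exact_mod_cast hk.2
    have hK1 : (1 : ℝ) ≤ Real.sqrt K := Real.one_le_sqrt.mpr (by linarith)
    -- each term `≤ 2m/k`
    have hterm : ∀ p ∈ A.filter (fun p ↦ kf p = k), 2 * m * d / ‖z p‖ ≤ 2 * m / k := by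
      intro p hp
      rw [Finset.mem_filter] at hp
      obtain ⟨hpA, hpk⟩ := hp
      obtain ⟨hlo, -, -, -⟩ := hmem p hpA
      rw [hpk] at hlo
      have hzp : 0 < ‖z p‖ := lt_of_lt_of_le (by positivity) hlo
      rw [div_le_div_iff₀ hzp (by positivity)]
      nlinarith [hlo]
    -- the fibre lies in the annulus `((k-1)d, (k+1)d]`
    have hsub : A.filter (fun p ↦ kf p = k) ⊆
        T.filter (fun p ↦ ((k : ℝ) - 1) * d < ‖z p‖ ∧ ‖z p‖ ≤ ((k : ℝ) + 1) * d) := by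
      intro p hp
      rw [Finset.mem_filter] at hp ⊢
      obtain ⟨hpA, hpk⟩ := hp
      obtain ⟨hlo, hhi, -, -⟩ := hmem p hpA
      rw [hpk] at hlo hhi
      refine ⟨(Finset.mem_filter.mp hpA).1, by nlinarith [hlo], hhi.le⟩
    have hcard := card_filter_annulus_le β c τ hc hτ (R₁ := ((k : ℝ) - 1) * d) (R₂ := ((k : ℝ) + 1) * d)
      (by nlinarith) (by nlinarith) T
    have hsq : Real.sqrt ((((k : ℝ) + 1) * d) ^ 2 - (((k : ℝ) - 1) * d) ^ 2) = 2 * d * Real.sqrt k := by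
      rw [show (((k : ℝ) + 1) * d) ^ 2 - (((k : ℝ) - 1) * d) ^ 2 = (2 * d) ^ 2 * k by ring,
        Real.sqrt_mul' _ (by positivity), Real.sqrt_sq (by positivity)]
    rw [hsq] at hcard
    have hcardA := (Nat.cast_le (α := ℝ)).mpr (Finset.card_le_card hsub)
    calc ∑ p ∈ A.filter (fun p ↦ kf p = k), 2 * m * d / ‖z p‖
        ≤ ∑ p ∈ A.filter (fun p ↦ kf p = k), (2 * m / k : ℝ) := Finset.sum_le_sum hterm
      _ = ((A.filter (fun p ↦ kf p = k)).card : ℝ) * (2 * m / k) := by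
          rw [Finset.sum_const, nsmul_eq_mul]
      _ ≤ (2 * (((k : ℝ) + 1) * d) / (‖c‖ * τ.im) + 1) * (2 * (2 * d * Real.sqrt k / ‖c‖ + 1)) *
            (2 * m / k) := by
          gcongr
          exact hcardA.trans hcard
      _ ≤ (4 * d / (‖c‖ * τ.im) + 1) * k * (2 * ((2 * d / ‖c‖ + 1) * Real.sqrt K)) * (2 * m / k) := by
          -- `2(k+1)d/(‖c‖ s) + 1 ≤ (4d/(‖c‖s) + 1) k` and `2d√k/‖c‖ + 1 ≤ (2d/‖c‖ + 1) √K`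
          have hf1 : 2 * (((k : ℝ) + 1) * d) / (‖c‖ * τ.im) + 1 ≤ (4 * d / (‖c‖ * τ.im) + 1) * k := by
            have h1 : 2 * (((k : ℝ) + 1) * d) / (‖c‖ * τ.im) = (2 * d / (‖c‖ * τ.im)) * (k + 1) := by ring
            rw [h1]
            have hpos : 0 ≤ 2 * d / (‖c‖ * τ.im) := by positivity
            have e4 : 4 * d / (‖c‖ * τ.im) = 2 * (2 * d / (‖c‖ * τ.im)) := by ring
            rw [e4]
            nlinarith [mul_nonneg hpos (sub_nonneg.mpr hk1)]
          have hf2 : 2 * (2 * d * Real.sqrt k / ‖c‖ + 1) ≤ 2 * ((2 * d / ‖c‖ + 1) * Real.sqrt K) := by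
            have hsk : Real.sqrt k ≤ Real.sqrt K := Real.sqrt_le_sqrt hkK
            have hpos : 0 ≤ 2 * d / ‖c‖ := by positivity
            have e : 2 * d * Real.sqrt k / ‖c‖ = (2 * d / ‖c‖) * Real.sqrt k := by ring
            rw [e]
            nlinarith [hsk, hpos, hK1, Real.sqrt_nonneg (k : ℝ)]
          gcongr
      _ = 4 * m * (4 * d / (‖c‖ * τ.im) + 1) * (2 * d / ‖c‖ + 1) * Real.sqrt K := by
          field_simp
          ring
  -- sum over the `≤ K` fibres, and `K √K ≤ (R/d)^{3/2}`
  have hKR : (K : ℝ) ≤ R / d := by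
    rw [hK]
    exact Nat.floor_le (by positivity)
  by_cases hK0 : K = 0
  · have : Finset.Icc 2 K = ∅ := by rw [hK0]; rfl
    rw [this, Finset.sum_empty]
    positivity
  have hKpos : (0 : ℝ) < K := by exact_mod_cast Nat.pos_of_ne_zero hK0
  have hRd : 0 < R / d := lt_of_lt_of_le hKpos hKR
  calc ∑ k ∈ Finset.Icc 2 K, ∑ p ∈ A.filter (fun p ↦ kf p = k), 2 * m * d / ‖z p‖
      ≤ ∑ k ∈ Finset.Icc 2 K, 4 * m * (4 * d / (‖c‖ * τ.im) + 1) * (2 * d / ‖c‖ + 1) * Real.sqrt K :=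
        Finset.sum_le_sum hfib
    _ = ((Finset.Icc 2 K).card : ℝ) * (4 * m * (4 * d / (‖c‖ * τ.im) + 1) * (2 * d / ‖c‖ + 1) * Real.sqrt K) := by
        rw [Finset.sum_const, nsmul_eq_mul]
    _ ≤ (K : ℝ) * (4 * m * (4 * d / (‖c‖ * τ.im) + 1) * (2 * d / ‖c‖ + 1) * Real.sqrt K) := by
        have hcardK : ((Finset.Icc 2 K).card : ℝ) ≤ K := by
          have : (Finset.Icc 2 K).card ≤ K := by rw [Nat.card_Icc]; omega
          exact_mod_cast this
        gcongr
    _ = 4 * m * (4 * d / (‖c‖ * τ.im) + 1) * (2 * d / ‖c‖ + 1) * ((K : ℝ) * Real.sqrt K) := by ring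
    _ ≤ 4 * m * (4 * d / (‖c‖ * τ.im) + 1) * (2 * d / ‖c‖ + 1) * ((R / d) * Real.sqrt (R / d)) := by
        gcongr

include hc hτ in
/-- **The boundary count**: the indices with `‖z_p‖ ≤ R + d` not in the inner range lie in the
annulus `(max(R−d,0), R+d]` or the disc of radius `2d`. [folklore] -/
theorem card_boundary_le (β : ℂ) {R d : ℝ} (hR : 0 ≤ R) (hd : 0 < d) (T : Finset (ℤ × ℤ)) :
    ((T.filter fun p ↦ ‖cosetPt β c τ p‖ ≤ R + d ∧
        ¬ (2 * d ≤ ‖cosetPt β c τ p‖ ∧ ‖cosetPt β c τ p‖ + d ≤ R)).card : ℝ) ≤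
      (2 * (R + d) / (‖c‖ * τ.im) + 1) * (2 * (2 * Real.sqrt ((R + d) * d) / ‖c‖ + 1)) +
        (2 * (2 * d) / (‖c‖ * τ.im) + 1) * (2 * (2 * d) / ‖c‖ + 1) := by
  classical
  set z := cosetPt β c τ with hz
  set R₁ := max (R - d) 0 with hR₁
  have hR₁0 : 0 ≤ R₁ := le_max_right _ _
  have hR₁2 : R₁ ≤ R + d := max_le (by linarith) (by linarith)
  have hsub : (T.filter fun p ↦ ‖z p‖ ≤ R + d ∧ ¬ (2 * d ≤ ‖z p‖ ∧ ‖z p‖ + d ≤ R)) ⊆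
      (T.filter fun p ↦ R₁ < ‖z p‖ ∧ ‖z p‖ ≤ R + d) ∪ (T.filter fun p ↦ ‖z p‖ ≤ 2 * d) := by
    intro p hp
    rw [Finset.mem_filter] at hp
    rw [Finset.mem_union, Finset.mem_filter, Finset.mem_filter]
    obtain ⟨hpT, hle, hnot⟩ := hp
    by_cases h2d : 2 * d ≤ ‖z p‖
    · left
      refine ⟨hpT, ?_, hle⟩
      have : ¬ ‖z p‖ + d ≤ R := fun h ↦ hnot ⟨h2d, h⟩
      rw [hR₁, max_lt_iff]
      constructor <;> linarith
    · right
      exact ⟨hpT, by linarith⟩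
  have h1 := card_filter_annulus_le β c τ hc hτ hR₁0 hR₁2 T
  have h2 := card_filter_norm_le β c τ hc hτ (r := 2 * d) (by linarith) T
  have hsq : Real.sqrt ((R + d) ^ 2 - R₁ ^ 2) ≤ 2 * Real.sqrt ((R + d) * d) := by
    have hle : (R + d) ^ 2 - R₁ ^ 2 ≤ 2 ^ 2 * ((R + d) * d) := by
      rw [hR₁]
      rcases le_total (R - d) 0 with h | h
      · rw [max_eq_right h]; nlinarith
      · rw [max_eq_left h]; nlinarith
    calc Real.sqrt ((R + d) ^ 2 - R₁ ^ 2) ≤ Real.sqrt (2 ^ 2 * ((R + d) * d)) := Real.sqrt_le_sqrt hle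
      _ = 2 * Real.sqrt ((R + d) * d) := by
          rw [Real.sqrt_mul' _ (by positivity), Real.sqrt_sq (by norm_num)]
  calc ((T.filter fun p ↦ ‖z p‖ ≤ R + d ∧ ¬ (2 * d ≤ ‖z p‖ ∧ ‖z p‖ + d ≤ R)).card : ℝ)
      ≤ (((T.filter fun p ↦ R₁ < ‖z p‖ ∧ ‖z p‖ ≤ R + d) ∪ (T.filter fun p ↦ ‖z p‖ ≤ 2 * d)).card : ℝ) := by
        exact_mod_cast Finset.card_le_card hsub
    _ ≤ ((T.filter fun p ↦ R₁ < ‖z p‖ ∧ ‖z p‖ ≤ R + d).card : ℝ) +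
          ((T.filter fun p ↦ ‖z p‖ ≤ 2 * d).card : ℝ) := by
        exact_mod_cast Finset.card_union_le _ _
    _ ≤ (2 * (R + d) / (‖c‖ * τ.im) + 1) * (2 * (Real.sqrt ((R + d) ^ 2 - R₁ ^ 2) / ‖c‖ + 1)) +
          (2 * (2 * d) / (‖c‖ * τ.im) + 1) * (2 * (2 * d) / ‖c‖ + 1) := add_le_add h1 h2
    _ ≤ _ := by gcongr

set_option maxHeartbeats 800000 in
include hτ in
/-- **Main estimate — sector sums over a coset of a plane lattice.** For `τ` with `Im τ > 0`,
`‖c‖ ≥ 1`, `m ≥ 1`, `R ≥ 0`, any shift `β` and any finite index set `T` containing all `p` with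
`‖β + c(p₁ + p₂τ)‖ ≤ R + ‖c‖ + ‖cτ‖`:

`‖Σ_{p ∈ T, ‖z_p‖ ≤ R} (z_p/‖z_p‖)^m‖ ≤ 16 (4κ/Im τ + 1)(4κ + 1) · m · (R + 1)(√R + 1)`,

`z_p = β + c(p₁ + p₂τ)`, `κ = 1 + ‖τ‖` — uniform in `c` and `β`. (The continuous sum vanishes by
rotation; the lattice sum differs from it by the total variation over the cells: `O(m R^{3/2})` from
the Lipschitz part and `O(R^{3/2})` from the boundary annulus.) This is the input "partial sums of a
Grössencharacter of non-zero frequency over a congruence class are `O(x^{3/4})`" for the continuation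
of Hecke `L`-functions of imaginary quadratic fields by `LSeriesContinuationOfPartialSums`. [folklore] -/
theorem norm_sum_sectorWeight_le (hc1 : 1 ≤ ‖c‖) {m : ℕ} (hm : 1 ≤ m) {R : ℝ} (hR : 0 ≤ R)
    (β : ℂ) (T : Finset (ℤ × ℤ))
    (hT : ∀ p : ℤ × ℤ, ‖cosetPt β c τ p‖ ≤ R + (‖c‖ + ‖c * τ‖) → p ∈ T) :
    ‖∑ p ∈ T.filter (fun p ↦ ‖cosetPt β c τ p‖ ≤ R), sectorWeight m (cosetPt β c τ p)‖ ≤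
      16 * (4 * (1 + ‖τ‖) / τ.im + 1) * (4 * (1 + ‖τ‖) + 1) * m * ((R + 1) * (Real.sqrt R + 1)) := by
  classical
  have hc0 : 0 < ‖c‖ := lt_of_lt_of_le one_pos hc1
  have hc : c ≠ 0 := norm_pos_iff.mp hc0
  set z := cosetPt β c τ with hz
  set d := ‖c‖ + ‖c * τ‖ with hd
  set κ := 1 + ‖τ‖ with hκ
  set s := τ.im with hs
  have hκ1 : 1 ≤ κ := by rw [hκ]; linarith [norm_nonneg τ]
  have hdκ : d = ‖c‖ * κ := by rw [hd, hκ, norm_mul]; ring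
  have hd1 : 1 ≤ d := by rw [hdκ]; nlinarith
  have hd0 : 0 < d := by linarith
  have hm1 : (1 : ℝ) ≤ m := by exact_mod_cast hm
  set P := 4 * κ / s + 1 with hP
  set Q := 4 * κ + 1 with hQ
  set W := (R + 1) * (Real.sqrt R + 1) with hW
  have hs0 : 0 < s := hτ
  have hP1 : 1 ≤ P := by
    have h4 : 0 ≤ 4 * κ / s := by positivity
    simp only [hP]; linarith
  have hQ1 : 1 ≤ Q := by simp only [hQ]; linarith
  have hW1 : 1 ≤ W := by simp only [hW]; nlinarith [Real.sqrt_nonneg R]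
  have hsqrt1 : Real.sqrt R ≤ Real.sqrt R + 1 := by linarith
  -- Step 0: the filtered sum is the sum of `discWeight`
  have hsum : ∑ p ∈ T.filter (fun p ↦ ‖z p‖ ≤ R), sectorWeight m (z p) = ∑ p ∈ T, discWeight m R (z p) := by
    unfold discWeight; rw [Finset.sum_filter]
  rw [hsum]
  -- Steps 1–2: variation
  have hvar := norm_sum_discWeight_le hc hτ hm R β T hT
  have hsplit : ∑ p ∈ T, (if R + d < ‖z p‖ then (0 : ℝ) else
      if 2 * d ≤ ‖z p‖ ∧ ‖z p‖ + d ≤ R then 2 * m * d / ‖z p‖ else 2) ≤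
      ∑ p ∈ T.filter (fun p ↦ 2 * d ≤ ‖z p‖ ∧ ‖z p‖ + d ≤ R), 2 * m * d / ‖z p‖ +
        2 * ((T.filter fun p ↦ ‖z p‖ ≤ R + d ∧ ¬ (2 * d ≤ ‖z p‖ ∧ ‖z p‖ + d ≤ R)).card : ℝ) := by
    calc _ ≤ ∑ p ∈ T, ((if 2 * d ≤ ‖z p‖ ∧ ‖z p‖ + d ≤ R then 2 * m * d / ‖z p‖ else 0) +
          (if ‖z p‖ ≤ R + d ∧ ¬ (2 * d ≤ ‖z p‖ ∧ ‖z p‖ + d ≤ R) then 2 else 0)) :=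
          Finset.sum_le_sum fun p _ ↦ variation_le (m := m) (R := R) hd0 ‖z p‖
      _ = _ := by
          rw [Finset.sum_add_distrib]
          congr 1
          · exact (Finset.sum_filter _ _).symm
          · rw [← Finset.sum_filter, Finset.sum_const, nsmul_eq_mul, mul_comm]
  -- Step 3: the three bounds
  have hT1 := sum_shells_le hc hτ β (m := m) hR hd0 T
  have hT2 := card_boundary_le hc hτ β hR hd0 T
  -- Step 4: domination by `P Q m W`
  have hRd : R / d * Real.sqrt (R / d) ≤ W := by
    have h1 : R / d ≤ R := div_le_self hR hd1
    have h2 : Real.sqrt (R / d) ≤ Real.sqrt R := Real.sqrt_le_sqrt h1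
    calc R / d * Real.sqrt (R / d) ≤ R * Real.sqrt R := by gcongr
      _ ≤ W := by rw [hW]; nlinarith [Real.sqrt_nonneg R]
  have hB1 : 4 * m * (4 * d / (‖c‖ * s) + 1) * (2 * d / ‖c‖ + 1) * (R / d * Real.sqrt (R / d)) ≤
      4 * P * Q * m * W := by
    have e1 : 4 * d / (‖c‖ * s) + 1 = P := by rw [hP, hdκ]; field_simp
    have e2 : 2 * d / ‖c‖ + 1 ≤ Q := by rw [hQ, hdκ]; field_simp; nlinarith
    rw [e1]
    have : 0 ≤ P := by linarith
    calc 4 * m * P * (2 * d / ‖c‖ + 1) * (R / d * Real.sqrt (R / d)) ≤ 4 * m * P * Q * W := by gcongr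
      _ = 4 * P * Q * m * W := by ring
  have hB2 : 2 * ((2 * (R + d) / (‖c‖ * s) + 1) * (2 * (2 * Real.sqrt ((R + d) * d) / ‖c‖ + 1))) ≤
      4 * P * Q * m * W := by
    -- `(R + d)/‖c‖ ≤ κ (R + 1)` and `√((R+d)d)/‖c‖ ≤ κ (√R + 1)`
    have hRdc : (R + d) / ‖c‖ ≤ κ * (R + 1) := by
      rw [div_le_iff₀ hc0, hdκ]
      have hκc : 0 ≤ κ * ‖c‖ - 1 := by nlinarith
      nlinarith [mul_nonneg hR hκc]
    have hRd' : R + d ≤ κ * (R + 1) * ‖c‖ := (div_le_iff₀ hc0).mp hRdc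
    have hsq : Real.sqrt ((R + d) * d) / ‖c‖ ≤ κ * (Real.sqrt R + 1) := by
      rw [div_le_iff₀ hc0]
      have h1 : (R + d) * d ≤ (κ * ‖c‖ * Real.sqrt (R + 1)) ^ 2 := by
        rw [mul_pow, Real.sq_sqrt (by positivity)]
        have hdd : d ≤ ‖c‖ * κ := hdκ.le
        calc (R + d) * d ≤ (κ * (R + 1) * ‖c‖) * (‖c‖ * κ) :=
              mul_le_mul hRd' hdd hd0.le (by positivity)
          _ = (κ * ‖c‖) ^ 2 * (R + 1) := by ring
      have h2 : Real.sqrt ((R + d) * d) ≤ κ * ‖c‖ * Real.sqrt (R + 1) := by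
        rw [← Real.sqrt_sq (by positivity : 0 ≤ κ * ‖c‖ * Real.sqrt (R + 1))]
        exact Real.sqrt_le_sqrt h1
      have h3 : Real.sqrt (R + 1) ≤ Real.sqrt R + 1 := by
        have := sqrt_add_le' hR zero_le_one
        rwa [Real.sqrt_one] at this
      calc Real.sqrt ((R + d) * d) ≤ κ * ‖c‖ * Real.sqrt (R + 1) := h2
        _ ≤ κ * ‖c‖ * (Real.sqrt R + 1) := by gcongr
        _ = κ * (Real.sqrt R + 1) * ‖c‖ := by ring
    have hf1 : 2 * (R + d) / (‖c‖ * s) + 1 ≤ P * (R + 1) := by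
      have e : 2 * (R + d) / (‖c‖ * s) = (2 / s) * ((R + d) / ‖c‖) := by field_simp
      rw [e, hP]
      have h2s : 0 ≤ 2 / s := by positivity
      have hκs : 2 * κ / s ≤ 4 * κ / s := div_le_div_of_nonneg_right (by nlinarith) hs0.le
      calc (2 / s) * ((R + d) / ‖c‖) + 1 ≤ (2 / s) * (κ * (R + 1)) + 1 * (R + 1) :=
            add_le_add (mul_le_mul_of_nonneg_left hRdc h2s) (by linarith)
        _ = (2 * κ / s + 1) * (R + 1) := by ring
        _ ≤ (4 * κ / s + 1) * (R + 1) := by gcongr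
    have hf2 : 2 * (2 * Real.sqrt ((R + d) * d) / ‖c‖ + 1) ≤ 2 * (Q * (Real.sqrt R + 1)) := by
      rw [hQ]
      have e : 2 * Real.sqrt ((R + d) * d) / ‖c‖ = 2 * (Real.sqrt ((R + d) * d) / ‖c‖) := by ring
      rw [e]
      have hx : 1 ≤ κ * (Real.sqrt R + 1) :=
        one_le_mul_of_one_le_of_one_le hκ1 (by linarith [Real.sqrt_nonneg R])
      linarith [hsq, hx, Real.sqrt_nonneg R]
    have hPpos : 0 ≤ P := by linarith
    calc 2 * ((2 * (R + d) / (‖c‖ * s) + 1) * (2 * (2 * Real.sqrt ((R + d) * d) / ‖c‖ + 1)))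
        ≤ 2 * ((P * (R + 1)) * (2 * (Q * (Real.sqrt R + 1)))) := by gcongr
      _ = 4 * P * Q * 1 * W := by rw [hW]; ring
      _ ≤ 4 * P * Q * m * W := by gcongr
  have hB3 : 2 * ((2 * (2 * d) / (‖c‖ * s) + 1) * (2 * (2 * d) / ‖c‖ + 1)) ≤ 2 * P * Q * m * W := by
    have e1 : 2 * (2 * d) / (‖c‖ * s) + 1 = P := by rw [hP, hdκ]; field_simp; ring
    have e2 : 2 * (2 * d) / ‖c‖ + 1 = Q := by rw [hQ, hdκ]; field_simp; ring
    rw [e1, e2]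
    have : 0 ≤ P * Q := by positivity
    nlinarith [mul_le_mul hm1 hW1 zero_le_one (by linarith), this]
  calc ‖∑ p ∈ T, discWeight m R (z p)‖ ≤ _ := hvar
    _ ≤ _ := hsplit
    _ ≤ 4 * P * Q * m * W + 2 * (((2 * (R + d) / (‖c‖ * s) + 1) * (2 * (2 * Real.sqrt ((R + d) * d) / ‖c‖ + 1)) +
          (2 * (2 * d) / (‖c‖ * s) + 1) * (2 * (2 * d) / ‖c‖ + 1))) :=
        add_le_add (hT1.trans hB1) (by gcongr)
    _ ≤ 4 * P * Q * m * W + (4 * P * Q * m * W + 2 * P * Q * m * W) := by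
        linarith [hB2, hB3]
    _ ≤ 16 * P * Q * m * W := by
        have : 0 ≤ P * Q * m * W := by positivity
        nlinarith

end Main




end Literature.NumberTheory.LFunctions.PlaneLattice

end
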